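import Literature.NumberTheory.Sieve.FGKMT2018RandomConstruction
import Literature.NumberTheory.Sieve.FGKMT2018BoxMoments
import HarnessLib

/-!
# Ford–Green–Konyagin–Maynard–Tao 2018 — §6 (6.10)–(6.12): the law of `ñ_p`, the quantities
# `X_p(a⃗)`, `Z_p(a⃗; n)`, the good primes `𝒫(a⃗)` and the conditional law of `n_p`; the edge
# probabilities `P(q ∈ e_p(a⃗))` of Theorem 4 in terms of them (PROVED)

Topic `Literature/NumberTheory/Sieve`. Source: K. Ford, B. Green, S. Konyagin, J. Maynard, T. Tao,
*Long gaps between primes*, J. Amer. Math. Soc. 31 (2018) 65–105 = arXiv:1412.5029, §6 pp. 17–18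
[FordGreenKonyaginMaynardTao2018]: «For each `p ∈ 𝒫`, let `ñ_p` denote the random integer with
probability density `P(ñ_p = n) := w(p, n) / Σ_{n'} w(p, n')` … (6.10)
`X_p(a⃗) := P(ñ_p + h_i p ∈ S(a⃗) for all i = 1, …, r)`, and let `𝒫(a⃗)` denote the set of all
the primes `p ∈ 𝒫` such that (6.11) `X_p(a⃗) = (1 + O_≤(1/log³ x)) σ^r` … If `p ∈ 𝒫 ∖ 𝒫(a⃗)` we
set `n_p = 0`. Otherwise … (6.12) `P(n_p = n | a⃗ = a) := Z_p(a⃗; n)/X_p(a⃗)`,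
`Z_p(a⃗; n) = 1_{n + h_j p ∈ S(a⃗) for j = 1, …, r} P(ñ_p = n)` … Substituting definition (6.12)
into the left hand side of (6.13), using (6.11), and observing that `q = n_p + h_i p` is only
possible if `p ∈ 𝒫(a⃗)`, we find that
`σ^{-r} Σ_i Σ_{p ∈ 𝒫(a⃗)} Z_p(a⃗; q − h_i p) = … = (1 + O(1/log³ x)) Σ_{p ∈ 𝒫} P(q ∈ e_p(a⃗) | a⃗)`
where `e_p(a⃗) = {n_p + h_i p : 1 ≤ i ≤ r} ∩ 𝒬 ∩ S(a⃗)` is as defined in Theorem 4.»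

This file formalises these DEFINITIONS for a deterministic residue vector `a : ℕ → ℕ`, a weight
`w : ℕ → ℤ → ℝ` with finite window `N` (Theorem 5: `N = FGKMT2018.weightWindow c x`), a shift set
`H ⊆ ℤ` and a target value `X₀` (= `σ^r`) with tolerance `η` (= `1/log³ x`), and PROVES the
deterministic plumbing of the deduction of Theorem 4 from Theorem 5:
* `lawTilde`, `Zp`, `Xp`, `goodPrimes`, `condLaw` — (6.10)–(6.12);
* `condLaw_isLaw` — the conditional law is a law on `N` (the «laws `ν p`» clause of
  `FordGreenKonyaginMaynardTao2018_theorem4`), for EVERY `p` (bad primes get `n_p = 0 ∈ N`);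
* `probInEdge_eq_sum` — `P(q ∈ e_p) = Σ_{h ∈ H} ν_p(q − h p)` for `q ∈ 𝒬 ∩ S(a⃗)`;
  `probInEdge_condLaw_of_good / _of_bad`, `sum_probInEdge_condLaw` — the displayed identity
  `Σ_{p ∈ 𝒫} P(q ∈ e_p(a⃗)) = Σ_{p ∈ 𝒫(a⃗)} Σ_{h ∈ H} Z_p(a⃗; q − h p) / X_p(a⃗)` (p. 18);
* `probInEdge_condLaw_le` — the sparsity bound (4.26) in the form
  `P(q ∈ e_p) ≤ #H · (sup w / Σ w) / ((1 − η) X₀)`;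
* `Zp_extendRes`, `boxExp_Zp`, `boxExp_Xp` — the bridge to the uniform residue box of
  `FGKMT2018UniformSieve` / `FGKMT2018BoxMoments`: `E_{a⃗} Z_p(a⃗; n) = P(n + hp ∈ S(a⃗) ∀ h) P(ñ_p = n)`
  and `E_{a⃗} X_p(a⃗) = Σ_n P(ñ_p = n) P(n + h p ∈ S(a⃗) ∀ h ∈ H)` (first display of the proof of
  Lemma 6.3, (6.16)), to which Lemma 6.1 (`lemma61_lower/upper`) applies.
-/

noncomputable section

open Finset

namespace Literature.NumberTheory.Sieve

namespace FGKMT2018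

/-! ### The law of `ñ_p` -/

/-- `P(ñ_p = n) := w(p, n) / Σ_{n' ∈ N} w(p, n')`. [cite: FordGreenKonyaginMaynardTao2018, §6 p. 17] -/
def lawTilde (w : ℕ → ℤ → ℝ) (N : Finset ℤ) (p : ℕ) (n : ℤ) : ℝ :=
  w p n / ∑ m ∈ N, w p m

/-- [cite: FordGreenKonyaginMaynardTao2018, §6 p. 17] -/
theorem lawTilde_nonneg {w : ℕ → ℤ → ℝ} (hw : ∀ p n, 0 ≤ w p n) (N : Finset ℤ) (p : ℕ) (n : ℤ) :
    0 ≤ lawTilde w N p n :=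
  div_nonneg (hw p n) (Finset.sum_nonneg fun m _ => hw p m)

/-- [cite: FordGreenKonyaginMaynardTao2018, §6 p. 17] -/
theorem sum_lawTilde {w : ℕ → ℤ → ℝ} (N : Finset ℤ) (p : ℕ) (h : ∑ m ∈ N, w p m ≠ 0) :
    ∑ n ∈ N, lawTilde w N p n = 1 := by
  unfold lawTilde
  rw [← Finset.sum_div, div_self h]

/-- [cite: FordGreenKonyaginMaynardTao2018, §6 p. 17] -/
theorem sum_lawTilde_le_one {w : ℕ → ℤ → ℝ} (N : Finset ℤ) (p : ℕ) :
    ∑ n ∈ N, lawTilde w N p n ≤ 1 := by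
  by_cases h : ∑ m ∈ N, w p m = 0
  · unfold lawTilde
    rw [← Finset.sum_div, h, div_zero]
    exact zero_le_one
  · rw [sum_lawTilde N p h]

/-- [cite: FordGreenKonyaginMaynardTao2018, §6 p. 17] -/
theorem lawTilde_eq_zero {w : ℕ → ℤ → ℝ} {N : Finset ℤ} {p : ℕ} {n : ℤ} (h : w p n = 0) :
    lawTilde w N p n = 0 := by
  simp [lawTilde, h]

/-- `P(ñ_p = n) ≤ W / T` when `w(p, ·) ≤ W` and `Σ_n w(p, n) ≥ T > 0` (the shape of (6.7):
`P(ñ_p = n) ≪ x^{-1/2-1/6+o(1)}` from (6.3), (6.6)). [cite: FordGreenKonyaginMaynardTao2018, (6.7) p. 17] -/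
theorem lawTilde_le {w : ℕ → ℤ → ℝ} {N : Finset ℤ} {p : ℕ} {n : ℤ} {W T : ℝ} (hW0 : 0 ≤ W)
    (hW : w p n ≤ W) (hT : T ≤ ∑ m ∈ N, w p m) (hT0 : 0 < T) : lawTilde w N p n ≤ W / T := by
  unfold lawTilde
  have hS : 0 < ∑ m ∈ N, w p m := lt_of_lt_of_le hT0 hT
  exact (div_le_div_of_nonneg_right hW hS.le).trans (div_le_div_of_nonneg_left hW0 hT0 hT)

/-! ### `Z_p(a⃗; n)`, `X_p(a⃗)`, the good primes `𝒫(a⃗)` and the conditional law of `n_p` -/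

/-- `Z_p(a⃗; n) := 1_{n + h p ∈ S(a⃗) for all h ∈ H} · P(ñ_p = n)` ((6.12)).
[cite: FordGreenKonyaginMaynardTao2018, (6.12) p. 18] -/
def Zp (x : ℕ) (a : ℕ → ℕ) (H : Finset ℤ) (w : ℕ → ℤ → ℝ) (N : Finset ℤ) (p : ℕ) (n : ℤ) : ℝ :=
  if ∀ h ∈ H, ∀ s ∈ primesS x, ¬ (n + h * (p : ℤ)) ≡ (a s : ℤ) [ZMOD (s : ℤ)]
  then lawTilde w N p n else 0

/-- `X_p(a⃗) := P(ñ_p + h p ∈ S(a⃗) for all h ∈ H) = Σ_n Z_p(a⃗; n)` ((6.10)).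
[cite: FordGreenKonyaginMaynardTao2018, (6.10) p. 18] -/
def Xp (x : ℕ) (a : ℕ → ℕ) (H : Finset ℤ) (w : ℕ → ℤ → ℝ) (N : Finset ℤ) (p : ℕ) : ℝ :=
  ∑ n ∈ N, Zp x a H w N p n

/-- `𝒫(a⃗) := {p ∈ 𝒫 : X_p(a⃗) = (1 + O_≤(η)) X₀}` ((6.11) with `X₀ = σ^r`, `η = 1/log³ x`).
[cite: FordGreenKonyaginMaynardTao2018, (6.11) p. 18] -/
def goodPrimes (x : ℕ) (a : ℕ → ℕ) (H : Finset ℤ) (w : ℕ → ℤ → ℝ) (N : Finset ℤ) (X₀ η : ℝ) :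
    Finset ℕ :=
  (primesHalf x).filter fun p => |Xp x a H w N p - X₀| ≤ η * X₀

/-- The conditional law of `n_p` given `a⃗`: `Z_p(a⃗; n)/X_p(a⃗)` for `p ∈ 𝒫(a⃗)`, the point mass
at `0` otherwise ((6.12) and «if `p ∈ 𝒫 ∖ 𝒫(a⃗)`, we set `n_p = 0`»).
[cite: FordGreenKonyaginMaynardTao2018, (6.12) p. 18] -/
def condLaw (x : ℕ) (a : ℕ → ℕ) (H : Finset ℤ) (w : ℕ → ℤ → ℝ) (N : Finset ℤ) (X₀ η : ℝ)
    (p : ℕ) (n : ℤ) : ℝ :=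
  if p ∈ goodPrimes x a H w N X₀ η then Zp x a H w N p n / Xp x a H w N p
  else if n = 0 then 1 else 0

variable {x : ℕ} {a : ℕ → ℕ} {H : Finset ℤ} {w : ℕ → ℤ → ℝ} {N : Finset ℤ} {X₀ η : ℝ}

/-- [cite: FordGreenKonyaginMaynardTao2018, (6.12) p. 18] -/
theorem Zp_nonneg (hw : ∀ p n, 0 ≤ w p n) (p : ℕ) (n : ℤ) : 0 ≤ Zp x a H w N p n := by
  unfold Zp
  split_ifs
  · exact lawTilde_nonneg hw N p n
  · exact le_rfl

/-- [cite: FordGreenKonyaginMaynardTao2018, (6.12) p. 18] -/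
theorem Zp_le_lawTilde (hw : ∀ p n, 0 ≤ w p n) (p : ℕ) (n : ℤ) :
    Zp x a H w N p n ≤ lawTilde w N p n := by
  unfold Zp
  split_ifs
  · exact le_rfl
  · exact lawTilde_nonneg hw N p n

/-- [cite: FordGreenKonyaginMaynardTao2018, (6.10) p. 18] -/
theorem Xp_nonneg (hw : ∀ p n, 0 ≤ w p n) (p : ℕ) : 0 ≤ Xp x a H w N p :=
  Finset.sum_nonneg fun n _ => Zp_nonneg hw p n

/-- `X_p(a⃗) ≤ 1`. [cite: FordGreenKonyaginMaynardTao2018, (6.10) p. 18] -/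
theorem Xp_le_one (hw : ∀ p n, 0 ≤ w p n) (p : ℕ) : Xp x a H w N p ≤ 1 :=
  (Finset.sum_le_sum fun n _ => Zp_le_lawTilde hw p n).trans (sum_lawTilde_le_one N p)

/-- [cite: FordGreenKonyaginMaynardTao2018, (6.11) p. 18] -/
theorem mem_goodPrimes {p : ℕ} :
    p ∈ goodPrimes x a H w N X₀ η ↔ p ∈ primesHalf x ∧ |Xp x a H w N p - X₀| ≤ η * X₀ :=
  Finset.mem_filter

/-- [cite: FordGreenKonyaginMaynardTao2018, (6.11) p. 18] -/
theorem goodPrimes_subset : goodPrimes x a H w N X₀ η ⊆ primesHalf x :=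
  Finset.filter_subset _ _

/-- For a good prime, `X_p(a⃗) ≥ (1 − η) X₀ > 0`. [cite: FordGreenKonyaginMaynardTao2018, (6.11)–(6.12)
p. 18 («From (6.11) we see that these random variables are well defined»)] -/
theorem Xp_ge_of_mem_goodPrimes {p : ℕ} (hp : p ∈ goodPrimes x a H w N X₀ η) :
    (1 - η) * X₀ ≤ Xp x a H w N p := by
  have h := (mem_goodPrimes.1 hp).2
  rw [abs_le] at h
  linarith [h.1]

/-- [cite: FordGreenKonyaginMaynardTao2018, (6.11)–(6.12) p. 18] -/
theorem Xp_pos_of_mem_goodPrimes (hX₀ : 0 < X₀) (hη : η < 1) {p : ℕ}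
    (hp : p ∈ goodPrimes x a H w N X₀ η) : 0 < Xp x a H w N p :=
  lt_of_lt_of_le (mul_pos (by linarith) hX₀) (Xp_ge_of_mem_goodPrimes hp)

/-- [cite: FordGreenKonyaginMaynardTao2018, (6.12) p. 18] -/
theorem condLaw_nonneg (hw : ∀ p n, 0 ≤ w p n) (p : ℕ) (n : ℤ) :
    0 ≤ condLaw x a H w N X₀ η p n := by
  unfold condLaw
  split_ifs
  · exact div_nonneg (Zp_nonneg hw p n) (Xp_nonneg hw p)
  · exact zero_le_one
  · exact le_rfl

/-- [cite: FordGreenKonyaginMaynardTao2018, (6.12) p. 18] -/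
theorem sum_condLaw (h0 : (0 : ℤ) ∈ N) (hX₀ : 0 < X₀) (hη : η < 1) (p : ℕ) :
    ∑ n ∈ N, condLaw x a H w N X₀ η p n = 1 := by
  unfold condLaw
  by_cases hp : p ∈ goodPrimes x a H w N X₀ η
  · simp only [if_pos hp]
    rw [← Finset.sum_div, div_eq_one_iff_eq (Xp_pos_of_mem_goodPrimes hX₀ hη hp).ne']
    rfl
  · simp only [if_neg hp]
    rw [Finset.sum_ite_eq' N (0 : ℤ) (fun _ => (1 : ℝ)), if_pos h0]

/-- [cite: FordGreenKonyaginMaynardTao2018, (6.12) p. 18] -/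
theorem condLaw_eq_zero_of_not_mem (hw : ∀ p n, 0 ≤ w p n) (hwN : ∀ p n, n ∉ N → w p n = 0)
    (h0 : (0 : ℤ) ∈ N) (p : ℕ) {n : ℤ} (hn : n ∉ N) : condLaw x a H w N X₀ η p n = 0 := by
  unfold condLaw
  split_ifs with hp hn0
  · have h1 : Zp x a H w N p n = 0 :=
      le_antisymm ((Zp_le_lawTilde hw p n).trans (lawTilde_eq_zero (hwN p n hn)).le)
        (Zp_nonneg hw p n)
    rw [h1, zero_div]
  · exact absurd (hn0 ▸ h0) hn
  · rfl

/-- **The conditional laws are laws** (the clause «for each `p ∈ 𝒫` a law `ν p` for the integer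
`n_p`, supported in the finite window `N`» of `FordGreenKonyaginMaynardTao2018_theorem4`), for a
non-negative weight vanishing off `N ∋ 0` and `0 < X₀`, `η < 1`.
[cite: FordGreenKonyaginMaynardTao2018, (6.12) p. 18] -/
theorem condLaw_isLaw (hw : ∀ p n, 0 ≤ w p n) (hwN : ∀ p n, n ∉ N → w p n = 0) (h0 : (0 : ℤ) ∈ N)
    (hX₀ : 0 < X₀) (hη : η < 1) (p : ℕ) :
    (∀ n, 0 ≤ condLaw x a H w N X₀ η p n) ∧ (∀ n, n ∉ N → condLaw x a H w N X₀ η p n = 0) ∧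
      ∑ n ∈ N, condLaw x a H w N X₀ η p n = 1 :=
  ⟨condLaw_nonneg hw p, fun _ hn => condLaw_eq_zero_of_not_mem hw hwN h0 p hn,
    sum_condLaw h0 hX₀ hη p⟩

/-- `0 ∈ [-⌊y⌋, ⌊y⌋]`, the window of Theorem 5. [cite: FordGreenKonyaginMaynardTao2018, Thm 5 p. 17] -/
theorem zero_mem_weightWindow (c : ℝ) (x : ℕ) : (0 : ℤ) ∈ weightWindow c x := by
  simp [weightWindow]

/-! ### Edge probabilities in terms of the law of `n_p` -/

/-- For `q ∈ 𝒬 ∩ S(a⃗)`, `p ≠ 0` and any law `ν p` vanishing off `N`: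
`P(q ∈ e_p) = Σ_{h ∈ H} ν_p(q − h p)`. [cite: FordGreenKonyaginMaynardTao2018, §6 p. 18] -/
theorem probInEdge_eq_sum {c : ℝ} (ν : ℕ → ℤ → ℝ) {p q : ℕ} (hν : ∀ n, n ∉ N → ν p n = 0)
    (hp : p ≠ 0) (hq : q ∈ sievedQ c x a) :
    probInEdge c x a H N ν p q = ∑ h ∈ H, ν p ((q : ℤ) - h * (p : ℤ)) := by
  classical
  unfold probInEdge
  have hp' : (p : ℤ) ≠ 0 := by exact_mod_cast hp
  -- the `n` with `q ∈ e_p(n)` are the `q − h p`, `h ∈ H`, lying in `N`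
  have hset : N.filter (fun n => q ∈ edge c x a H p n) =
      (H.filter fun h => (q : ℤ) - h * (p : ℤ) ∈ N).image fun h => (q : ℤ) - h * (p : ℤ) := by
    ext n
    simp only [Finset.mem_filter, Finset.mem_image, edge, hq, true_and]
    constructor
    · rintro ⟨hn, h, hH, hqn⟩
      refine ⟨h, ⟨hH, ?_⟩, ?_⟩
      · rw [hqn]; ring_nf; exact hn
      · rw [hqn]; ring
    · rintro ⟨h, ⟨hH, hN⟩, rfl⟩
      exact ⟨hN, h, hH, by ring⟩
  rw [hset, Finset.sum_image]
  · rw [Finset.sum_filter]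
    refine Finset.sum_congr rfl fun h _ => ?_
    split_ifs with hN
    · rfl
    · exact (hν _ hN).symm
  · intro h₁ _ h₂ _ heq
    have : h₁ * (p : ℤ) = h₂ * (p : ℤ) := by linarith
    exact mul_right_cancel₀ hp' this

/-- A prime of `𝒫` is positive. [cite: FordGreenKonyaginMaynardTao2018, (3.4)] -/
theorem pos_of_mem_primesHalf {p : ℕ} (hp : p ∈ primesHalf x) : 0 < p := by
  simp only [primesHalf, Finset.mem_filter] at hp
  exact hp.2.1.pos

/-- For `q ∈ 𝒬 ∩ S(a⃗)`, `p ∈ 𝒫` and any `h ∈ ℤ`, `q ≠ h p` (as `q > x ≥ p` are primes).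
[cite: FordGreenKonyaginMaynardTao2018, §6 p. 18 («`q = n_p + h_i p` is only possible if
`p ∈ 𝒫(a⃗)`»)] -/
theorem ne_mul_of_mem {c : ℝ} {p q : ℕ} (hp : p ∈ primesHalf x) (hq : q ∈ sievedQ c x a)
    (h : ℤ) : (q : ℤ) ≠ h * (p : ℤ) := by
  simp only [primesHalf, Finset.mem_filter, Finset.mem_Icc] at hp
  simp only [sievedQ, primesQ, Finset.mem_filter, Finset.mem_Icc] at hq
  obtain ⟨⟨_, hpx⟩, hpp, _⟩ := hp
  obtain ⟨⟨⟨hxq, _⟩, hqp⟩, _⟩ := hq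
  intro heq
  have hdvd : (p : ℤ) ∣ (q : ℤ) := ⟨h, by rw [heq]; ring⟩
  have hdvd' : p ∣ q := by exact_mod_cast hdvd
  rcases (Nat.dvd_prime hqp).1 hdvd' with h1 | h2
  · exact hpp.one_lt.ne' h1
  · omega

/-- For a BAD prime (`n_p = 0`) and `q ∈ 𝒬 ∩ S(a⃗)`: `P(q ∈ e_p) = 0`.
[cite: FordGreenKonyaginMaynardTao2018, §6 p. 18] -/
theorem probInEdge_condLaw_of_bad {c : ℝ} {p q : ℕ} (hp : p ∈ primesHalf x)
    (hpg : p ∉ goodPrimes x a H w N X₀ η) (hq : q ∈ sievedQ c x a) (h0 : (0 : ℤ) ∈ N) :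
    probInEdge c x a H N (condLaw x a H w N X₀ η) p q = 0 := by
  have hν : ∀ n, n ∉ N → condLaw x a H w N X₀ η p n = 0 := by
    intro n hn
    unfold condLaw
    rw [if_neg hpg, if_neg]
    rintro rfl
    exact hn h0
  rw [probInEdge_eq_sum _ hν (pos_of_mem_primesHalf hp).ne' hq]
  refine Finset.sum_eq_zero fun h _ => ?_
  unfold condLaw
  rw [if_neg hpg, if_neg]
  intro heq
  exact ne_mul_of_mem hp hq h (by linarith)

/-- For a GOOD prime and `q ∈ 𝒬 ∩ S(a⃗)`:
`P(q ∈ e_p(a⃗)) = Σ_{h ∈ H} Z_p(a⃗; q − h p) / X_p(a⃗)`.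
[cite: FordGreenKonyaginMaynardTao2018, §6 p. 18] -/
theorem probInEdge_condLaw_of_good {c : ℝ} (hw : ∀ p n, 0 ≤ w p n)
    (hwN : ∀ p n, n ∉ N → w p n = 0) (h0 : (0 : ℤ) ∈ N) {p q : ℕ}
    (hpg : p ∈ goodPrimes x a H w N X₀ η) (hq : q ∈ sievedQ c x a) :
    probInEdge c x a H N (condLaw x a H w N X₀ η) p q =
      (∑ h ∈ H, Zp x a H w N p ((q : ℤ) - h * (p : ℤ))) / Xp x a H w N p := by
  have hp : p ∈ primesHalf x := goodPrimes_subset hpg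
  rw [probInEdge_eq_sum _ (fun n hn => condLaw_eq_zero_of_not_mem hw hwN h0 p hn)
    (pos_of_mem_primesHalf hp).ne' hq, Finset.sum_div]
  refine Finset.sum_congr rfl fun h _ => ?_
  unfold condLaw
  rw [if_pos hpg]

/-- **The covering sum of Theorem 4 in terms of `Z_p`, `X_p`** (p. 18): for `q ∈ 𝒬 ∩ S(a⃗)`,
`Σ_{p ∈ 𝒫} P(q ∈ e_p(a⃗)) = Σ_{p ∈ 𝒫(a⃗)} Σ_{h ∈ H} Z_p(a⃗; q − h p) / X_p(a⃗)`.
[cite: FordGreenKonyaginMaynardTao2018, §6 p. 18] -/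
theorem sum_probInEdge_condLaw {c : ℝ} (hw : ∀ p n, 0 ≤ w p n)
    (hwN : ∀ p n, n ∉ N → w p n = 0) (h0 : (0 : ℤ) ∈ N) {q : ℕ} (hq : q ∈ sievedQ c x a) :
    ∑ p ∈ primesHalf x, probInEdge c x a H N (condLaw x a H w N X₀ η) p q =
      ∑ p ∈ goodPrimes x a H w N X₀ η,
        (∑ h ∈ H, Zp x a H w N p ((q : ℤ) - h * (p : ℤ))) / Xp x a H w N p := by
  classical
  rw [← Finset.sum_filter_add_sum_filter_not (primesHalf x)
    (fun p => p ∈ goodPrimes x a H w N X₀ η)]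
  have hfilter : (primesHalf x).filter (fun p => p ∈ goodPrimes x a H w N X₀ η) =
      goodPrimes x a H w N X₀ η := by
    ext p
    simp only [Finset.mem_filter]
    exact ⟨fun h => h.2, fun h => ⟨goodPrimes_subset h, h⟩⟩
  rw [hfilter]
  have hzero : ∑ p ∈ (primesHalf x).filter (fun p => p ∉ goodPrimes x a H w N X₀ η),
      probInEdge c x a H N (condLaw x a H w N X₀ η) p q = 0 := by
    refine Finset.sum_eq_zero fun p hp => ?_
    rw [Finset.mem_filter] at hp
    exact probInEdge_condLaw_of_bad hp.1 hp.2 hq h0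
  rw [hzero, add_zero]
  exact Finset.sum_congr rfl fun p hp => probInEdge_condLaw_of_good hw hwN h0 hp hq

/-- **Sparsity (4.26) in terms of the weight**: for `q ∈ 𝒬 ∩ S(a⃗)`, `p ∈ 𝒫`,
`w(p, ·) ≤ W` and `Σ_n w(p, n) ≥ T > 0`:
`P(q ∈ e_p(a⃗)) ≤ #H · (W/T) / ((1 − η) X₀)`. (With (6.3), (6.6), (6.9): `W/T ≤ x^{-2/3 + o(1)}`,
`X₀ = σ^r = x^{-o(1)}`, `#H ≤ log^{1/5} x`, giving `≤ x^{-1/2-1/10}`.)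
[cite: FordGreenKonyaginMaynardTao2018, (4.26), (6.7) pp. 13, 17] -/
theorem probInEdge_condLaw_le {c : ℝ} (hw : ∀ p n, 0 ≤ w p n) (hwN : ∀ p n, n ∉ N → w p n = 0)
    (h0 : (0 : ℤ) ∈ N) (hX₀ : 0 < X₀) (hη : η < 1) {p q : ℕ}
    (hp : p ∈ primesHalf x) (hq : q ∈ sievedQ c x a) {W T : ℝ} (hW : ∀ n, w p n ≤ W)
    (hT : T ≤ ∑ m ∈ N, w p m) (hT0 : 0 < T) :
    probInEdge c x a H N (condLaw x a H w N X₀ η) p q ≤ #H * (W / T) / ((1 - η) * X₀) := by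
  have hW0 : 0 ≤ W := (hw p 0).trans (hW 0)
  have hRHS : 0 ≤ #H * (W / T) / ((1 - η) * X₀) :=
    div_nonneg (mul_nonneg (Nat.cast_nonneg _) (div_nonneg hW0 hT0.le))
      (mul_nonneg (by linarith) hX₀.le)
  by_cases hpg : p ∈ goodPrimes x a H w N X₀ η
  · rw [probInEdge_condLaw_of_good hw hwN h0 hpg hq]
    have hX := Xp_pos_of_mem_goodPrimes hX₀ hη hpg
    have hXge := Xp_ge_of_mem_goodPrimes hpg
    have hnum : ∑ h ∈ H, Zp x a H w N p ((q : ℤ) - h * (p : ℤ)) ≤ #H * (W / T) := by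
      calc ∑ h ∈ H, Zp x a H w N p ((q : ℤ) - h * (p : ℤ))
            ≤ ∑ h ∈ H, (W / T) := Finset.sum_le_sum fun h _ =>
              (Zp_le_lawTilde hw p _).trans (lawTilde_le hW0 (hW _) hT hT0)
        _ = #H * (W / T) := by rw [Finset.sum_const, nsmul_eq_mul]
    have hnum0 : 0 ≤ #H * (W / T) := mul_nonneg (Nat.cast_nonneg _) (div_nonneg hW0 hT0.le)
    calc (∑ h ∈ H, Zp x a H w N p ((q : ℤ) - h * (p : ℤ))) / Xp x a H w N p
          ≤ #H * (W / T) / Xp x a H w N p := div_le_div_of_nonneg_right hnum hX.le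
      _ ≤ #H * (W / T) / ((1 - η) * X₀) :=
          div_le_div_of_nonneg_left hnum0 (mul_pos (by linarith) hX₀) hXge
  · rw [probInEdge_condLaw_of_bad hp hpg hq h0]
    exact hRHS

/-! ### Bridge to the uniform residue box: `E_{a⃗} Z_p` and `E_{a⃗} X_p` -/

/-- With `a⃗ = extendRes 𝒮 f` (the box format): `Z_p(a⃗; n) = 1_{ {n + hp : h ∈ H} ⊆ S(a⃗)} P(ñ_p = n)`.
[cite: FordGreenKonyaginMaynardTao2018, (6.12) p. 18] -/
theorem Zp_extendRes (f : (s : ℕ) → s ∈ primesS x → ℕ) (p : ℕ) (n : ℤ) :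
    Zp x (extendRes (primesS x) f) H w N p n =
      siftInd (primesS x) (H.image fun h => n + h * (p : ℤ)) f * lawTilde w N p n := by
  have hiff : (∀ h ∈ H, ∀ s ∈ primesS x,
      ¬ (n + h * (p : ℤ)) ≡ ((extendRes (primesS x) f s : ℕ) : ℤ) [ZMOD (s : ℤ)]) ↔
      ∀ s (hs : s ∈ primesS x), ∀ m ∈ H.image (fun h => n + h * (p : ℤ)),
        ¬ m ≡ (f s hs : ℤ) [ZMOD (s : ℤ)] := by
    constructor
    · intro hC s hs m hm
      obtain ⟨h, hh, rfl⟩ := Finset.mem_image.1 hm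
      have := hC h hh s hs
      rwa [extendRes_apply f hs] at this
    · intro hC h hh s hs
      have := hC s hs (n + h * (p : ℤ)) (Finset.mem_image.2 ⟨h, hh, rfl⟩)
      rwa [extendRes_apply f hs]
  unfold Zp siftInd
  by_cases hC : ∀ s (hs : s ∈ primesS x), ∀ m ∈ H.image (fun h => n + h * (p : ℤ)),
      ¬ m ≡ (f s hs : ℤ) [ZMOD (s : ℤ)]
  · rw [if_pos (hiff.2 hC), if_pos hC, one_mul]
  · rw [if_neg (fun h => hC (hiff.1 h)), if_neg hC, zero_mul]

/-- `E_{a⃗} Z_p(a⃗; n) = P({n + hp : h ∈ H} ⊆ S(a⃗)) · P(ñ_p = n)`, the expectation over the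
uniform residue box (`FGKMT2018.boxExp`); Lemma 6.1 (`lemma61_lower/upper`) evaluates the first
factor as `(1 + O(log^{-16} x)) σ^{#H}` for distinct shifts.
[cite: FordGreenKonyaginMaynardTao2018, Lemma 6.3 (proof, (6.16)) p. 18] -/
theorem boxExp_Zp (p : ℕ) (n : ℤ) :
    boxExp (primesS x) (fun f => Zp x (extendRes (primesS x) f) H w N p n) =
      siftProb (primesS x) (H.image fun h => n + h * (p : ℤ)) * lawTilde w N p n := by
  simp_rw [Zp_extendRes, mul_comm _ (lawTilde w N p n)]
  rw [boxExp_const_mul, boxExp_siftInd, mul_comm]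

/-- **(6.16), expectation side**: `E_{a⃗} X_p(a⃗) = Σ_{n ∈ N} P(ñ_p = n) · P({n + hp : h ∈ H} ⊆ S(a⃗))`
(«performing the conditional expectation over `ñ_p` first»).
[cite: FordGreenKonyaginMaynardTao2018, Lemma 6.3 (proof, (6.16)) p. 18] -/
theorem boxExp_Xp (p : ℕ) :
    boxExp (primesS x) (fun f => Xp x (extendRes (primesS x) f) H w N p) =
      ∑ n ∈ N, siftProb (primesS x) (H.image fun h => n + h * (p : ℤ)) * lawTilde w N p n := by
  unfold Xp
  rw [boxExp_sum]
  exact Finset.sum_congr rfl fun n _ => boxExp_Zp p n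

end FGKMT2018

end Literature.NumberTheory.Sieve
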